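import Summits.BirchSwinnertonDyer.BirchSwinnertonDyer.Theorems.Rank1ResidualJetCarrierMultKitOrder
import Summits.BirchSwinnertonDyer.BirchSwinnertonDyer.Theorems.Rank1ResidualJetCarrierShaKernelSwap
import HarnessLib

/-!
# T1 JET (cell `bsd-jet`), bucket B multiplicative: pv-2's literal-model ROW KITS re-keyed to NAMED PRINT ONLY —
# `bsdp_of_jetRowCarrierMult_{of_serreWitnesses, of_ram, of_irr_of_order}` with `hJ`, `hMcU`, McCallum 5.2,
# `hrec`, `hD36`, `hlev` FED BY NAME

HONEST FRAMING (programme file `BSD-LIT2PART-PROGRAMME-v1.md` §HONESTY, verbatim): «no tranche here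
proves BSD; ARM L moves the LITERAL column of an r ≤ 1 census into the kernel-proved-modulo-named-print
column; ARM P changes what «named print» is worth.» THEOREMS ONLY (seat `bsd-jet-pv-2`, session g7;
`--supports stmt-BirchSwinnertonDyer-14418`, helper); nothing is booked by this file (bookings are referee
A's; the JET@p∣N rows of record stand on the documentary strikes R409/R466/R516–R518); 0 classes move.

WHAT. Sibling of `Rank1ResidualJetRecordsKitSwap` (p567356) / `…KitSwapThree` (p568451) / `…KitSwapNe`: the three
bucket-B multiplicative literal-model kits of `Theorems/Rank1ResidualJetCarrierMultKit[Order]` (carrier `q = p`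
multiplicative, `ρ̄_{E,p}` onto from three Serre witnesses ∕ an irreducible Frobenius + a (ram) witness ∕ an
irreducible Frobenius + a Frobenius of order divisible by `p`; `TamLocal` certificate AT `p`) with the numeric
front ends VERBATIM and the consumer replaced by `JET.bsdp_of_carrierMultCertificate_level_of_surj_of_swapLiterature`
(p565138). Displayed class-free binders: EXACTLY {`hPT` (∀ K), `hF1`, `h372`, `hGZK`, `hKo` (∀), `hmod`}.
References: [cite: Jetchev2008, Cor. 1.5 (p. 812)] [cite: Serre1972, §2.8 Prop. 19, §2.4 Prop. 15] [cite: Mazur1978, §6 Prop. 6.3 (1)]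
[cite: Wuthrich2014, Lemma 20 (p. 399)] [cite: SilvermanATAEC1994, IV.9.4] [cite: GrossLMS1991, Thm. 1.3, Prop. 3.7 (2)].
Design: no definitions. Axioms: `propext`, `Classical.choice`, `Quot.sound`.
-/

set_option autoImplicit false

noncomputable section

open scoped Classical

open WeierstrassCurve Literature.NumberTheory.EllipticCurves
  Literature.NumberTheory.EllipticCurves.ModularForms Literature.NumberTheory.GaloisCohomology
  Literature.NumberTheory.EllipticCurves.Rank1Residual
  Literature.NumberTheory.EllipticCurves.Rank1Residual.Typed
  Literature.NumberTheory.EllipticCurves.Rank1Residual.X11RankOneCertificates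
  Summit.BirchSwinnertonDyer.BirchSwinnertonDyer.Rank1Residual
  Summit.BirchSwinnertonDyer.BirchSwinnertonDyer.Rank1Residual.IntModel
  Summit.BirchSwinnertonDyer.BirchSwinnertonDyer.Rank1Residual.X11RankOne
  Summit.BirchSwinnertonDyer.BirchSwinnertonDyer.Rank2Observatory.Tam
  Summit.BirchSwinnertonDyer.Rank1Residual Summit.BirchSwinnertonDyer.Rank1Residual.X11b

namespace Summit.BirchSwinnertonDyer.Rank1Residual.JET

/-- **`bsdp_of_jetRowCarrierMult_of_serreWitnesses` re-keyed to named print only** (bucket B, `p ≥ 5` multiplicative, three Serre witnesses; numeric front-end VERBATIM; consumer `…Mult…_level_of_surj_of_swapLiterature`). Displayed: {`hPT`, `hF1`, `h372`, `hGZK`, `hKo`, `hmod`}. CONDITIONAL on every binder; per pair. [cite: Jetchev2008, Cor. 1.5 (p. 812)] [cite: Serre1972, §2.8 Prop. 19] -/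
theorem bsdp_of_jetRowCarrierMult_of_serreWitnesses_of_swapLiterature (p : ℕ) (hp : p.Prime) (h5 : 5 ≤ p)
    (a1 a2 a3 a4 a6 : ℤ)
    (h0 : discOf [a1, a2, a3, a4, a6] ≠ 0) (bad : List (ℕ × ℕ × ℕ)) (hprime : ∀ t ∈ bad, t.1.Prime)
    (hsupp : (discOf [a1, a2, a3, a4, a6]).natAbs = (bad.map fun t => t.1 ^ t.2.2).prod)
    (hmin : ∀ t ∈ bad,
      (¬ (t.1 : ℤ) ^ 12 ∣ discOf [a1, a2, a3, a4, a6] ∨ ¬ (t.1 : ℤ) ^ 4 ∣ c4Of [a1, a2, a3, a4, a6]) ∨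
      (t.1 = 2 ∧ (16 : ℤ) ∣ c4Of [a1, a2, a3, a4, a6] ∧ (64 : ℤ) ∣ c6Of [a1, a2, a3, a4, a6] ∧
        ¬ (((16 : ℤ) ∣ c4Of [a1, a2, a3, a4, a6] / 16 ∧
            ((32 : ℤ) ∣ c6Of [a1, a2, a3, a4, a6] / 64 ∨ (32 : ℤ) ∣ c6Of [a1, a2, a3, a4, a6] / 64 - 8)) ∨
          (4 : ℤ) ∣ c6Of [a1, a2, a3, a4, a6] / 64 + 1)) ∨
      (t.1 = 3 ∧ (3 : ℤ) ^ 8 ∣ c6Of [a1, a2, a3, a4, a6] ∧ ¬ (3 : ℤ) ^ 9 ∣ c6Of [a1, a2, a3, a4, a6]))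
    (hpΔ : (p : ℤ) ∣ (⟨a1, a2, a3, a4, a6⟩ : WeierstrassCurve ℤ).Δ)
    (hpc₄ : ¬ (p : ℤ) ∣ (⟨a1, a2, a3, a4, a6⟩ : WeierstrassCurve ℤ).c₄)
    (ℓ₁ ℓ₂ ℓ₃ : ℕ) (hℓ₁ : ℓ₁.Prime) (hℓ₂ : ℓ₂.Prime) (hℓ₃ : ℓ₃.Prime)
    (h2ℓ₁ : ℓ₁ ≠ 2) (h2ℓ₂ : ℓ₂ ≠ 2) (h2ℓ₃ : ℓ₃ ≠ 2) (hℓ₁p : ℓ₁ ≠ p) (hℓ₂p : ℓ₂ ≠ p) (hℓ₃p : ℓ₃ ≠ p)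
    (hΔ₁ : ¬ (ℓ₁ : ℤ) ∣ (⟨a1, a2, a3, a4, a6⟩ : WeierstrassCurve ℤ).Δ)
    (hΔ₂ : ¬ (ℓ₂ : ℤ) ∣ (⟨a1, a2, a3, a4, a6⟩ : WeierstrassCurve ℤ).Δ)
    (hΔ₃ : ¬ (ℓ₃ : ℤ) ∣ (⟨a1, a2, a3, a4, a6⟩ : WeierstrassCurve ℤ).Δ)
    {n₁ n₂ n₃ : ℕ} (hc₁ : countPoints [a1, a2, a3, a4, a6] ℓ₁ = n₁)
    (hc₂ : countPoints [a1, a2, a3, a4, a6] ℓ₂ = n₂) (hc₃ : countPoints [a1, a2, a3, a4, a6] ℓ₃ = n₃)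
    (hi : IsSquare ((((ℓ₁ : ℤ) + 1 - n₁ : ℤ) : ZMod p) ^ 2 - 4 * ℓ₁) ∧
      (((ℓ₁ : ℤ) + 1 - n₁ : ℤ) : ZMod p) ^ 2 - 4 * ℓ₁ ≠ 0 ∧ (((ℓ₁ : ℤ) + 1 - n₁ : ℤ) : ZMod p) ≠ 0)
    (hii : ¬ IsSquare ((((ℓ₂ : ℤ) + 1 - n₂ : ℤ) : ZMod p) ^ 2 - 4 * ℓ₂) ∧
      (((ℓ₂ : ℤ) + 1 - n₂ : ℤ) : ZMod p) ≠ 0)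
    (hiii : ∃ u : ZMod p, (((ℓ₃ : ℤ) + 1 - n₃ : ℤ) : ZMod p) ^ 2 = u * ℓ₃ ∧
      u ≠ 0 ∧ u ≠ 1 ∧ u ≠ 2 ∧ u ≠ 4 ∧ u ^ 2 - 3 * u + 1 ≠ 0)
    (hPT : ∀ (K : Type) [Field K] [NumberField K], poitouTate_selmerStructure_duality_conj K)
    (hF1 : Gross1991_heegnerPoint_sub_ratTorsion_mem_E0)
    (h372 : GrossLMS1991.prop37_2_frobeniusCongruence)
    (hGZK : rank_eq_analyticRank_of_analyticRank_le_one)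
    (hKo : ∀ (N : ℕ) [NeZero N] (W : WeierstrassCurve ℚ) (K : Type) [Field K] [NumberField K],
      kolyvagin N W K)
    (hmod : exists_isNewformOf)
    (W : WeierstrassCurve ℚ) (hW : W = ⟨a1, a2, a3, a4, a6⟩)
    {N : ℕ} [NeZero N] {K : Type} [Field K] [NumberField K] (hK : IsImaginaryQuadratic K)
    (hD3 : NumberField.discr K ≠ -3) (hD4 : NumberField.discr K ≠ -4)
    (hH : SatisfiesHeegnerHypothesis N K) {P : (W.baseChange K).toAffine.Point}
    (hP : IsHeegnerPoint N W K P) (hnt : ¬ IsOfFinAddOrder P)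
    (hI : (haveI := Fact.mk hp;
      padicValNat p (AddSubgroup.zmultiples P).index ≤
        padicValNat p ((W.baseChange ℚ_[p]).localTamagawaNumber ℤ_[p])))
    (hr : W.analyticRank ≤ 1) {s : ℚ} (hs : shaAn W = (s : ℂ)) (hv : padicValRat p s = 0) :
    BSDp W p := by
  subst hW
  haveI hE : (⟨a1, a2, a3, a4, a6⟩ : WeierstrassCurve ℚ).IsElliptic :=
    X11b.isElliptic_of_discOf_ne_zero a1 a2 a3 a4 a6 h0
  haveI hM : (⟨a1, a2, a3, a4, a6⟩ : WeierstrassCurve ℚ).IsGloballyMinimal :=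
    X11b.isGloballyMinimal_of_krausCriterion_support a1 a2 a3 a4 a6 bad hprime hsupp hmin
  haveI : Fact (Nat.Prime p) := ⟨hp⟩
  haveI := Fact.mk hℓ₁; haveI := Fact.mk hℓ₂; haveI := Fact.mk hℓ₃
  have hI0 : integralModelInt (⟨a1, a2, a3, a4, a6⟩ : WeierstrassCurve ℚ) = ⟨a1, a2, a3, a4, a6⟩ :=
    integralModelInt_eq_of_map_eq _ (map_mk_int a1 a2 a3 a4 a6)
  -- the three witness counts in `Nat.card` form
  have hn₁ : Nat.card (((⟨a1, a2, a3, a4, a6⟩ : WeierstrassCurve ℤ).map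
      (Int.castRingHom (ZMod ℓ₁))).toAffine.Point) = n₁ := by
    exact_mod_cast (X11b.natCard_point_eq_countPoints a1 a2 a3 a4 a6 ℓ₁ h2ℓ₁ hΔ₁).trans hc₁
  have hn₂ : Nat.card (((⟨a1, a2, a3, a4, a6⟩ : WeierstrassCurve ℤ).map
      (Int.castRingHom (ZMod ℓ₂))).toAffine.Point) = n₂ := by
    exact_mod_cast (X11b.natCard_point_eq_countPoints a1 a2 a3 a4 a6 ℓ₂ h2ℓ₂ hΔ₂).trans hc₂
  have hn₃ : Nat.card (((⟨a1, a2, a3, a4, a6⟩ : WeierstrassCurve ℤ).map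
      (Int.castRingHom (ZMod ℓ₃))).toAffine.Point) = n₃ := by
    exact_mod_cast (X11b.natCard_point_eq_countPoints a1 a2 a3 a4 a6 ℓ₃ h2ℓ₃ hΔ₃).trans hc₃
  -- `ρ̄_{E,p}` onto (Serre 1972 Prop. 19)
  have hsurj : (⟨a1, a2, a3, a4, a6⟩ : WeierstrassCurve ℚ).HasSurjectiveModNGaloisRep p :=
    hasSurjectiveModNGaloisRep_of_intModel_of_serreWitnesses hI0 p h5 ℓ₁ ℓ₂ ℓ₃ hℓ₁p hℓ₂p hℓ₃p hΔ₁
      hΔ₂ hΔ₃ hn₁ hn₂ hn₃ hi hii hiii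
  -- multiplicative at `p` (the carrier)
  have hmult : (⟨a1, a2, a3, a4, a6⟩ : WeierstrassCurve ℚ).HasMultiplicativeReductionAtPrime p :=
    hasMultiplicativeReductionAtPrime_of_intModel hI0 p hpΔ hpc₄
  exact bsdp_of_carrierMultCertificate_level_of_surj_of_swapLiterature hPT hF1 h372 hGZK hKo hmod _ p hK hD3 hD4 hH
    hP hnt (by omega) hmult hsurj hI hr hs hv

/-- **`bsdp_of_jetRowCarrierMult_of_ram` re-keyed to named print only** (bucket B, `p` odd multiplicative, irreducible Frobenius + (ram) witness; numeric front-end VERBATIM; consumer `…Mult…_level_of_surj_of_swapLiterature`). Displayed: {`hPT`, `hF1`, `h372`, `hGZK`, `hKo`, `hmod`}. [cite: Jetchev2008, Cor. 1.5 (p. 812)] [cite: Mazur1978, §6 Prop. 6.3 (1)] [cite: Serre1972, §2.4 Prop. 15] -/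
theorem bsdp_of_jetRowCarrierMult_of_ram_of_swapLiterature (p : ℕ) (hp : p.Prime) (hp2 : p ≠ 2)
    (a1 a2 a3 a4 a6 : ℤ)
    (h0 : discOf [a1, a2, a3, a4, a6] ≠ 0) (bad : List (ℕ × ℕ × ℕ)) (hprime : ∀ t ∈ bad, t.1.Prime)
    (hsupp : (discOf [a1, a2, a3, a4, a6]).natAbs = (bad.map fun t => t.1 ^ t.2.2).prod)
    (hmin : ∀ t ∈ bad,
      (¬ (t.1 : ℤ) ^ 12 ∣ discOf [a1, a2, a3, a4, a6] ∨ ¬ (t.1 : ℤ) ^ 4 ∣ c4Of [a1, a2, a3, a4, a6]) ∨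
      (t.1 = 2 ∧ (16 : ℤ) ∣ c4Of [a1, a2, a3, a4, a6] ∧ (64 : ℤ) ∣ c6Of [a1, a2, a3, a4, a6] ∧
        ¬ (((16 : ℤ) ∣ c4Of [a1, a2, a3, a4, a6] / 16 ∧
            ((32 : ℤ) ∣ c6Of [a1, a2, a3, a4, a6] / 64 ∨ (32 : ℤ) ∣ c6Of [a1, a2, a3, a4, a6] / 64 - 8)) ∨
          (4 : ℤ) ∣ c6Of [a1, a2, a3, a4, a6] / 64 + 1)) ∨
      (t.1 = 3 ∧ (3 : ℤ) ^ 8 ∣ c6Of [a1, a2, a3, a4, a6] ∧ ¬ (3 : ℤ) ^ 9 ∣ c6Of [a1, a2, a3, a4, a6]))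
    (hpΔ : (p : ℤ) ∣ (⟨a1, a2, a3, a4, a6⟩ : WeierstrassCurve ℤ).Δ)
    (hpc₄ : ¬ (p : ℤ) ∣ (⟨a1, a2, a3, a4, a6⟩ : WeierstrassCurve ℤ).c₄)
    (ℓ : ℕ) (hℓ : ℓ.Prime) (h2ℓ : ℓ ≠ 2) (hℓp : ℓ ≠ p)
    (hΔℓ : ¬ (ℓ : ℤ) ∣ (⟨a1, a2, a3, a4, a6⟩ : WeierstrassCurve ℤ).Δ)
    {n : ℕ} (hc : countPoints [a1, a2, a3, a4, a6] ℓ = n)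
    (hnoroot : ∀ t : ZMod p, t ^ 2 - (((ℓ : ℤ) + 1 - n : ℤ) : ZMod p) * t + (ℓ : ZMod p) ≠ 0)
    (m : ℕ) (hm : m.Prime) (hmp : m ≠ p) (hmΔ : (m : ℤ) ∣ (⟨a1, a2, a3, a4, a6⟩ : WeierstrassCurve ℤ).Δ)
    (hmc₄ : ¬ (m : ℤ) ∣ (⟨a1, a2, a3, a4, a6⟩ : WeierstrassCurve ℤ).c₄) {e : ℕ}
    (hme : (m : ℤ) ^ e ∣ (⟨a1, a2, a3, a4, a6⟩ : WeierstrassCurve ℤ).Δ)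
    (hme' : ¬ (m : ℤ) ^ (e + 1) ∣ (⟨a1, a2, a3, a4, a6⟩ : WeierstrassCurve ℤ).Δ) (hpe : ¬ p ∣ e)
    (hPT : ∀ (K : Type) [Field K] [NumberField K], poitouTate_selmerStructure_duality_conj K)
    (hF1 : Gross1991_heegnerPoint_sub_ratTorsion_mem_E0)
    (h372 : GrossLMS1991.prop37_2_frobeniusCongruence)
    (hGZK : rank_eq_analyticRank_of_analyticRank_le_one)
    (hKo : ∀ (N : ℕ) [NeZero N] (W : WeierstrassCurve ℚ) (K : Type) [Field K] [NumberField K],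
      kolyvagin N W K)
    (hmod : exists_isNewformOf)
    (W : WeierstrassCurve ℚ) (hW : W = ⟨a1, a2, a3, a4, a6⟩)
    {N : ℕ} [NeZero N] {K : Type} [Field K] [NumberField K] (hK : IsImaginaryQuadratic K)
    (hD3 : NumberField.discr K ≠ -3) (hD4 : NumberField.discr K ≠ -4)
    (hH : SatisfiesHeegnerHypothesis N K) {P : (W.baseChange K).toAffine.Point}
    (hP : IsHeegnerPoint N W K P) (hnt : ¬ IsOfFinAddOrder P)
    (hI : (haveI := Fact.mk hp;
      padicValNat p (AddSubgroup.zmultiples P).index ≤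
        padicValNat p ((W.baseChange ℚ_[p]).localTamagawaNumber ℤ_[p])))
    (hr : W.analyticRank ≤ 1) {s : ℚ} (hs : shaAn W = (s : ℂ)) (hv : padicValRat p s = 0) :
    BSDp W p := by
  subst hW
  haveI hE : (⟨a1, a2, a3, a4, a6⟩ : WeierstrassCurve ℚ).IsElliptic :=
    X11b.isElliptic_of_discOf_ne_zero a1 a2 a3 a4 a6 h0
  haveI hM : (⟨a1, a2, a3, a4, a6⟩ : WeierstrassCurve ℚ).IsGloballyMinimal :=
    X11b.isGloballyMinimal_of_krausCriterion_support a1 a2 a3 a4 a6 bad hprime hsupp hmin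
  haveI : Fact (Nat.Prime p) := ⟨hp⟩
  haveI := Fact.mk hℓ
  have hI0 : integralModelInt (⟨a1, a2, a3, a4, a6⟩ : WeierstrassCurve ℚ) = ⟨a1, a2, a3, a4, a6⟩ :=
    integralModelInt_eq_of_map_eq _ (map_mk_int a1 a2 a3 a4 a6)
  have hn : Nat.card (((⟨a1, a2, a3, a4, a6⟩ : WeierstrassCurve ℤ).map
      (Int.castRingHom (ZMod ℓ))).toAffine.Point) = n := by
    exact_mod_cast (X11b.natCard_point_eq_countPoints a1 a2 a3 a4 a6 ℓ h2ℓ hΔℓ).trans hc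
  -- `E[p]` irreducible (Mazur 1978 Prop. 6.3 (1)) and a (ram) witness ⇒ `ρ̄_{E,p}` onto
  have hirr : Irr (⟨a1, a2, a3, a4, a6⟩ : WeierstrassCurve ℚ) p :=
    hasIrreducibleModPGaloisRep_of_intModel_of_noroot hI0 p ℓ hℓp hΔℓ hn hnoroot
  have hram : Ram (⟨a1, a2, a3, a4, a6⟩ : WeierstrassCurve ℚ) p :=
    ram_of_intModel hI0 p m hm hmp hmΔ hmc₄ hme hme' hpe
  have hsurj : Surj (⟨a1, a2, a3, a4, a6⟩ : WeierstrassCurve ℚ) p :=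
    surj_of_irr_of_ram _ p hirr hram
  -- multiplicative at `p`
  have hmult : (⟨a1, a2, a3, a4, a6⟩ : WeierstrassCurve ℚ).HasMultiplicativeReductionAtPrime p :=
    hasMultiplicativeReductionAtPrime_of_intModel hI0 p hpΔ hpc₄
  exact bsdp_of_carrierMultCertificate_level_of_surj_of_swapLiterature hPT hF1 h372 hGZK hKo hmod _ p hK hD3 hD4 hH
    hP hnt hp2 hmult hsurj hI hr hs hv

/-- **`bsdp_of_jetRowCarrierMult_of_irr_of_order` re-keyed to named print only** (bucket B, `p` odd multiplicative, irreducible Frobenius + a Frobenius of order divisible by `p`; numeric front-end VERBATIM; consumer `…Mult…_level_of_surj_of_swapLiterature`). Displayed: {`hPT`, `hF1`, `h372`, `hGZK`, `hKo`, `hmod`}. [cite: Jetchev2008, Cor. 1.5 (p. 812)] [cite: Serre1972, §2.4 Prop. 15] -/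
theorem bsdp_of_jetRowCarrierMult_of_irr_of_order_of_swapLiterature (p : ℕ) (hp : p.Prime) (hp2 : p ≠ 2)
    (a1 a2 a3 a4 a6 : ℤ)
    (h0 : discOf [a1, a2, a3, a4, a6] ≠ 0) (bad : List (ℕ × ℕ × ℕ)) (hprime : ∀ t ∈ bad, t.1.Prime)
    (hsupp : (discOf [a1, a2, a3, a4, a6]).natAbs = (bad.map fun t => t.1 ^ t.2.2).prod)
    (hmin : ∀ t ∈ bad,
      (¬ (t.1 : ℤ) ^ 12 ∣ discOf [a1, a2, a3, a4, a6] ∨ ¬ (t.1 : ℤ) ^ 4 ∣ c4Of [a1, a2, a3, a4, a6]) ∨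
      (t.1 = 2 ∧ (16 : ℤ) ∣ c4Of [a1, a2, a3, a4, a6] ∧ (64 : ℤ) ∣ c6Of [a1, a2, a3, a4, a6] ∧
        ¬ (((16 : ℤ) ∣ c4Of [a1, a2, a3, a4, a6] / 16 ∧
            ((32 : ℤ) ∣ c6Of [a1, a2, a3, a4, a6] / 64 ∨ (32 : ℤ) ∣ c6Of [a1, a2, a3, a4, a6] / 64 - 8)) ∨
          (4 : ℤ) ∣ c6Of [a1, a2, a3, a4, a6] / 64 + 1)) ∨
      (t.1 = 3 ∧ (3 : ℤ) ^ 8 ∣ c6Of [a1, a2, a3, a4, a6] ∧ ¬ (3 : ℤ) ^ 9 ∣ c6Of [a1, a2, a3, a4, a6]))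
    (hpΔ : (p : ℤ) ∣ (⟨a1, a2, a3, a4, a6⟩ : WeierstrassCurve ℤ).Δ)
    (hpc₄ : ¬ (p : ℤ) ∣ (⟨a1, a2, a3, a4, a6⟩ : WeierstrassCurve ℤ).c₄)
    (ℓ₁ ℓ₂ : ℕ) (hℓ₁ : ℓ₁.Prime) (hℓ₂ : ℓ₂.Prime) (h2ℓ₁ : ℓ₁ ≠ 2) (h2ℓ₂ : ℓ₂ ≠ 2)
    (hpℓ₁ : ℓ₁ ≠ p) (hpℓ₂ : ℓ₂ ≠ p)
    (hΔ₁ : ¬ (ℓ₁ : ℤ) ∣ (⟨a1, a2, a3, a4, a6⟩ : WeierstrassCurve ℤ).Δ)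
    (hΔ₂ : ¬ (ℓ₂ : ℤ) ∣ (⟨a1, a2, a3, a4, a6⟩ : WeierstrassCurve ℤ).Δ)
    {n₁ n₂ : ℕ} (hc₁ : countPoints [a1, a2, a3, a4, a6] ℓ₁ = n₁)
    (hc₂ : countPoints [a1, a2, a3, a4, a6] ℓ₂ = n₂)
    (hi : ∀ c : ZMod p, c ^ 2 - (((ℓ₁ : ℤ) + 1 - n₁ : ℤ) : ZMod p) * c + ℓ₁ ≠ 0)
    (hii : (ℓ₂ : ZMod p) = 1 ∧ (((ℓ₂ : ℤ) + 1 - n₂ : ℤ) : ZMod p) = 2 ∧ ¬ p ^ 2 ∣ n₂)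
    (hPT : ∀ (K : Type) [Field K] [NumberField K], poitouTate_selmerStructure_duality_conj K)
    (hF1 : Gross1991_heegnerPoint_sub_ratTorsion_mem_E0)
    (h372 : GrossLMS1991.prop37_2_frobeniusCongruence)
    (hGZK : rank_eq_analyticRank_of_analyticRank_le_one)
    (hKo : ∀ (N : ℕ) [NeZero N] (W : WeierstrassCurve ℚ) (K : Type) [Field K] [NumberField K],
      kolyvagin N W K)
    (hmod : exists_isNewformOf)
    (W : WeierstrassCurve ℚ) (hW : W = ⟨a1, a2, a3, a4, a6⟩)
    {N : ℕ} [NeZero N] {K : Type} [Field K] [NumberField K] (hK : IsImaginaryQuadratic K)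
    (hD3 : NumberField.discr K ≠ -3) (hD4 : NumberField.discr K ≠ -4)
    (hH : SatisfiesHeegnerHypothesis N K) {P : (W.baseChange K).toAffine.Point}
    (hP : IsHeegnerPoint N W K P) (hnt : ¬ IsOfFinAddOrder P)
    (hI : (haveI := Fact.mk hp;
      padicValNat p (AddSubgroup.zmultiples P).index ≤
        padicValNat p ((W.baseChange ℚ_[p]).localTamagawaNumber ℤ_[p])))
    (hr : W.analyticRank ≤ 1) {s : ℚ} (hs : shaAn W = (s : ℂ)) (hv : padicValRat p s = 0) :
    BSDp W p := by
  subst hW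
  haveI hE : (⟨a1, a2, a3, a4, a6⟩ : WeierstrassCurve ℚ).IsElliptic :=
    X11b.isElliptic_of_discOf_ne_zero a1 a2 a3 a4 a6 h0
  haveI hM : (⟨a1, a2, a3, a4, a6⟩ : WeierstrassCurve ℚ).IsGloballyMinimal :=
    X11b.isGloballyMinimal_of_krausCriterion_support a1 a2 a3 a4 a6 bad hprime hsupp hmin
  haveI : Fact (Nat.Prime p) := ⟨hp⟩
  haveI := Fact.mk hℓ₁; haveI := Fact.mk hℓ₂
  have hI0 : integralModelInt (⟨a1, a2, a3, a4, a6⟩ : WeierstrassCurve ℚ) = ⟨a1, a2, a3, a4, a6⟩ :=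
    integralModelInt_eq_of_map_eq _ (map_mk_int a1 a2 a3 a4 a6)
  -- the two witness counts in `Nat.card` form
  have hn₁ : Nat.card (((⟨a1, a2, a3, a4, a6⟩ : WeierstrassCurve ℤ).map
      (Int.castRingHom (ZMod ℓ₁))).toAffine.Point) = n₁ := by
    exact_mod_cast (X11b.natCard_point_eq_countPoints a1 a2 a3 a4 a6 ℓ₁ h2ℓ₁ hΔ₁).trans hc₁
  have hn₂ : Nat.card (((⟨a1, a2, a3, a4, a6⟩ : WeierstrassCurve ℤ).map
      (Int.castRingHom (ZMod ℓ₂))).toAffine.Point) = n₂ := by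
    exact_mod_cast (X11b.natCard_point_eq_countPoints a1 a2 a3 a4 a6 ℓ₂ h2ℓ₂ hΔ₂).trans hc₂
  -- `ρ̄_{E,p}` onto: irreducible Frobenius at `ℓ₁`, Frobenius of order `p` at `ℓ₂`
  have hsurj : (⟨a1, a2, a3, a4, a6⟩ : WeierstrassCurve ℚ).HasSurjectiveModNGaloisRep p :=
    GaloisImage.hasSurjectiveModNGaloisRep_of_intModel_of_irr_of_order hI0 p ℓ₁ ℓ₂ hpℓ₁ hpℓ₂ hΔ₁
      hΔ₂ hn₁ hn₂ hi hii.1 hii.2.1 hii.2.2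
  -- multiplicative at `p`
  have hmult : (⟨a1, a2, a3, a4, a6⟩ : WeierstrassCurve ℚ).HasMultiplicativeReductionAtPrime p :=
    hasMultiplicativeReductionAtPrime_of_intModel hI0 p hpΔ hpc₄
  exact bsdp_of_carrierMultCertificate_level_of_surj_of_swapLiterature hPT hF1 h372 hGZK hKo hmod _ p hK hD3 hD4 hH
    hP hnt hp2 hmult hsurj hI hr hs hv

end Summit.BirchSwinnertonDyer.Rank1Residual.JET

end
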